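import Summits.BirchSwinnertonDyer.Rank1Residual.Partition.CornersAll
import Summits.BirchSwinnertonDyer.Rank1Residual.WAll.Target
import Literature.NumberTheory.EllipticCurves.BurungaleSkinnerTianWan2024.SupersingularPPartOPEN
import Literature.NumberTheory.EllipticCurves.ComplexMultiplicationNotSemistable
import HarnessLib

/-!
# PRINT tier (D-0131 (2)), cell `bsd-print-x6`, leaf A6 = `ClassX6 W p ∧ r_an = 0`: the leaf BY NAME
# from Burungale–Skinner–Tian–Wan Thm. 1.5 AS PRINTED (one binder + Gross–Zagier–Kolyvagin), and the
# kernel partition with the A6 corner DELETED (seat `bsd-print-x6-p1`, strategy «BSTW 2024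
# arXiv:2409.01350 Thm 1.3/1.5 r0 p-part BY NAME: type the hypotheses exactly, discharge per class,
# file the class theorem»)

HONEST FRAMING. NOTHING ASSERTED about any curve; no `def`, no named fact, no `@[conjecture]` is
introduced; nothing is booked by this file. Every theorem is a composition of landed declarations BY
NAME. The one non-published input is the tree's explicitly labelled OPEN binder
`BurungaleSkinnerTianWan2024.thm15_pPart_OPEN` (`[claim: BurungaleSkinnerTianWan2024, under-review]`;
arXiv:2409.01350v2, Thm. 1.5, PRE — typed ≠ proved ≠ endorsed), taken as an explicit hypothesis: every
closer below is CONDITIONAL on it. CURRENCY (cell referee pre-ruling R-0.1, HOME/REFEREE.md §0): a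
closure through an `*_OPEN` binder is NOT bookable in PARTITION currency today; the 13 census cells of
A6 (12 @ `p = 3`, 22678e1 @ 5) are already PROVED per pair by name (R302/R303/R318/R635); this file
concerns the CLASS row only and moves no number. «beyond-print theorem: NO» — every statement here is
inside the printed scope of BSTW Thm. 1.5.

WHAT IS NEW (dedup, R-0.2). The per-pair by-name class theorem on this binder is ALREADY the tree's
`BurungaleSkinnerTianWan2024.X6.bsdp_of_thm15_OPEN'` / `X6.bsdp_of_classX6_of_OPEN'`
(`SupersingularPPartOPEN.lean`: `thm15_pPart_OPEN → GZK → p ≠ 2 → ClassX6 W p → r_an ≤ 1 → BSDp W p`),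
and the W-ALL row 6 `WAllCornerX6r0` is closed in the tree from Thm. 1.3 (Kobayashi's main conjecture)
+ EIGHT published facts (`WAll.wallCornerX6r0_of_bstw13_OPEN`, `…_of_BSTW13_tiers`; Wuthrich 2014
Prop. 21, Kobayashi 2003 Thm. 1.2, B. D. Kim 2013 Cor. 3.15, modularity ×3, GZK, Diamond's refined
Serre). Not in the tree before this file: (i) row 6 from Thm. 1.5 ITSELF — the printed `p`-part
theorem — with the MINIMAL binder set {Thm. 1.5 (PRE), GZK (PUB)} (`PrintX6.wallCornerX6r0_of_bstw15_OPEN`);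
(ii) the binder-agnostic DELETION LEMMA `PrintX6.bsdp_allCurves_of_not_corner_of_not_cornerF_of_wallCornerX6r0`:
ANY proof of `WAllCornerX6r0` removes the conjunct `¬ (ClassX6 W p ∧ W.analyticRank = 0)` from the
kernel partition `CornersAll.bsdp_allCurves_of_not_corner_of_not_cornerF` (eight non-CM corners ↦
seven), all fourteen published facts of that theorem unchanged; (iii) its instance on Thm. 1.5
(`…_of_bstw15_OPEN`) and the `Corners.bsdp_of_not_corner'` shape (`PrintX6.bsdp_of_not_corner'_of_bstw15_OPEN`);
(iv) the hypothesis-by-hypothesis DISCHARGE record `PrintX6.thm15_hypotheses_of_leaf`.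

## The printed statement and its typing (audit protocol §1 A, at the page)

Held text `paper:arxiv-2409.01350`, chunk p0004 = printed p. 4 of arXiv v2 (TeX label `corA_thmA`),
verbatim: «**Theorem 1.5.** Let `E/ℚ` be a semistable elliptic curve, and `p > 2` a supersingular
prime. If `p = 3`, suppose that (1.7) holds. If `ord_{s=1} L(s, E/ℚ) = r ≤ 1`, then the `p`-part of
the BSD formula is true, i.e. `|L^{(r)}(1,E/ℚ)/(Ω_E R(E/ℚ))|_p^{-1} = |#Ш(E/ℚ) · ∏_{q∣N} c_q(E/ℚ)|_p^{-1}`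
for `Ω_E ∈ ℂ^×` the Néron period and `R(E/ℚ)` the regulator. Moreover, the same holds for any
quadratic twist `E^K` as in Theorem 1.3.» with (§1.2.1, p. 6, display (1.7) = TeX (h4)) «we assume
`a_p(E) := p + 1 − #E(𝔽_p) = 0`» («this is only an extra condition when `p = 3`», p. 3) and (Conj. 1.1,
p. 3) `|p|_p = 1/p`. The binder `thm15_pPart_OPEN` (its docstring quotes the same lines) reads, for a
globally minimal `W` (so `W.frobeniusTrace p = a_p`, `W.realPeriodRat = Ω_E`):

| printed hypothesis / datum | binder `thm15_pPart_OPEN` | on the leaf A6 (`p` odd), discharged by |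
|---|---|---|
| `E/ℚ` semistable | `Semistable W` | `ClassX6 W p` conjunct 2 (`hX.2.1`) |
| `p > 2` | `p ≠ 2` | the partition's domain (`hdom` / `hp`; X5 = `p = 2` is excluded) |
| `p` supersingular (good, `a_p ≡ 0 mod p`) | `GoodSS W p` | `ClassX6 W p` conjunct 1 (`hX.1`) |
| (1.7) if `p = 3`: `a_3 = 0` | `p = 3 → W.frobeniusTrace 3 = 0` | `BurungaleSkinnerTianWan2024.h4_of_classX6` (conjunct 3: `5 ≤ p ∨ a_3 = 0`) |
| `ord_{s=1} L(s,E) = r ≤ 1` | `W.analyticRank ≤ 1` | `r_an = 0` on A6 |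
| conclusion, `p`-part display (no torsion term) | `∃ q : ℚ, L^{(r)}(E,1)/(Ω·Reg) = q ∧ ord_p q = ord_p #Ш + ord_p ∏ c_ℓ` | ⟶ `BSDp W p` by `Rank1Residual.bsdp_of_padicVal_printShape` (GZK for `rank = r_an` and `Ш` finite; the torsion `p`-part is killed by (irr) = `Rank1Residual.ClassX6.irr`, Serre 1972 §1.11 Prop. 12, a tree THEOREM on the class) — this composition IS `X6.bsdp_of_thm15_OPEN'` |
| twist clause («Moreover …») | not in this binder (`thm15_twist_pPart_OPEN`, class X7 sub-family) | not used on A6 |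

No printed hypothesis is dropped or strengthened; (irr), `a_p = 0` (`Supersingular.ClassX6.frobeniusTrace_eq_zero`)
and `¬ cm` (`Rank1Residual.ClassX6.not_hasCM`: a CM curve over `ℚ` is never semistable) are tree
theorems on the class, never binders. The Néron period normalisation (`Ω_E` vs. `Ω_E^+`) could differ
by a factor `2` only, invisible at odd `p`.

## Residual (for the cell's planner, D-0059)

The leaf is closed BY NAME modulo exactly ONE named statement, `thm15_pPart_OPEN` (equivalently, for
`r = 0`, Thm. 1.3 = `Supersingular.BurungaleSkinnerTianWan2024_thm13_OPEN` + published control, the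
tree's `Supersingular.X6.bsdp_of_BSTW13_OPEN_of_analyticRank_eq_zero`). Its discharge
(`theorem … : thm15_pPart_OPEN`) is the refereeing / re-proof of BSTW Part II — in the tree this is the
research route `SignedLowerHalves`, crux `KobayashiLowerHalfSemistable` (stmt 19000; bsd-ssimc tiers:
`p ≥ 5` cell-verified PASS, `p = 3` located residual (3-ii)♭, flag `BSTW13-p3-OhtaES-preprint`).
No certificate (image / (irr) / `p ∤ N·Tam`) is needed on A6: every hypothesis of the printed theorem
is decided by the class predicate itself.

References: [BurungaleSkinnerTianWan2024] arXiv:2409.01350v2 Thm. 1.3 (p. 3), Thm. 1.5 (p. 4), (1.7)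
(p. 6); `Partition/CornersAll.lean`, `Partition/Corners.lean`, `WAll/Target.lean` (row 6),
`WAll/AltClosersPre.lean`, `WAll/AltClosersBSTW24.lean`, `Supersingular/KobayashiMainConjecture.lean`;
HOME/REFEREE.md §0 (R-0.1 – R-0.6).
-/

set_option autoImplicit false

noncomputable section

open scoped Classical NumberField

open WeierstrassCurve Literature.NumberTheory.EllipticCurves
  Literature.NumberTheory.EllipticCurves.Rank1Residual Literature.NumberTheory.EllipticCurves.ModularForms
  Literature.NumberTheory.EllipticCurves.BurungaleSkinnerTianWan2024

namespace Summit.BirchSwinnertonDyer.Rank1Residual.PrintX6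

open Summit.BirchSwinnertonDyer

section Discharge

variable (W : WeierstrassCurve ℚ) [W.IsElliptic] [W.IsGloballyMinimal] (p : ℕ) [Fact p.Prime]

omit [W.IsElliptic] in
/-- **DISCHARGE RECORD (audit §1 B): the leaf A6 at an odd prime meets EVERY printed hypothesis of
BSTW Thm. 1.5**, in the binder's order — `p ≠ 2` (domain), `Semistable W` (X6 conjunct 2),
`GoodSS W p` (X6 conjunct 1), (1.7) at `p = 3` (`h4_of_classX6`, from X6 conjunct 3), `r_an ≤ 1`
(from `r_an = 0`). One tree lemma per step; no `*_OPEN` step; no certificate.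
[cite: BurungaleSkinnerTianWan2024, Thm. 1.5 (p. 4) and (1.7) (p. 6) (hypotheses only; PRE, nothing asserted)] -/
theorem thm15_hypotheses_of_leaf (hp : p ≠ 2) (hX : ClassX6 W p) (h0 : W.analyticRank = 0) :
    p ≠ 2 ∧ Semistable W ∧ GoodSS W p ∧ (p = 3 → W.frobeniusTrace 3 = 0) ∧ W.analyticRank ≤ 1 :=
  ⟨hp, hX.2.1, hX.1, h4_of_classX6 W p hX, by omega⟩

/-- The by-name inputs that the bridge to Miller's `BSD(E,p)` consumes on the leaf are tree THEOREMS
on the class, not binders: `E[p]` irreducible (Serre 1972 §1.11 Prop. 12, `ClassX6.irr`), `a_p = 0`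
is not even needed by Thm. 1.5, and the curve is not CM (`ClassX6.not_hasCM`). Recorded as one
conjunction for the referee's table. [cite: Serre1972, §1.11 Prop. 12] -/
theorem irr_and_not_hasCM_of_leaf (hp : p ≠ 2) (hX : ClassX6 W p) : Irr W p ∧ ¬ W.HasCM :=
  ⟨ClassX6.irr W p hp hX, ClassX6.not_hasCM W hX⟩

end Discharge

/-! ### Row 6 of W-ALL (= leaf A6 in the partition's reading) from Thm. 1.5 as printed -/

/-- **Leaf A6 BY NAME from BSTW Thm. 1.5 (PRE) + Gross–Zagier–Kolyvagin (PUB) — minimal binder set.**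
`WAllCornerX6r0` (non-CM `W`, `p ≠ 2`, `ClassX6 W p`, `r_an = 0` ⇒ `BSDp W p`) follows from the
printed `p`-part theorem `thm15_pPart_OPEN` and `rank_eq_analyticRank_of_analyticRank_le_one` alone,
through the tree's `X6.bsdp_of_thm15_OPEN'` (the `¬ W.HasCM` binder of the row is not used: it is a
consequence of semistability). Compare `WAll.wallCornerX6r0_of_bstw13_OPEN` (Thm. 1.3 + eight
published facts). CONDITIONAL on the PRE binder; closes nothing; books nothing (R-0.1).
[cite: BurungaleSkinnerTianWan2024, Thm. 1.5 (p. 4; PRE, OPEN binder)] [cite: Miller2011LMS, §1 and Def. 1.1] -/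
theorem wallCornerX6r0_of_bstw15_OPEN (hBSTW : thm15_pPart_OPEN)
    (hGZK : rank_eq_analyticRank_of_analyticRank_le_one) : WAllCornerX6r0 :=
  fun W _ _ p _ _ hp hX h0 ↦ X6.bsdp_of_thm15_OPEN' hBSTW hGZK W p hp hX (le_of_eq_of_le h0 zero_le_one)

/-! ### The kernel partition with the A6 corner deleted -/

section Partition

variable {W : WeierstrassCurve ℚ} [W.IsElliptic] [W.IsGloballyMinimal] {p : ℕ} [Fact p.Prime]

/-- **DELETION LEMMA (binder-agnostic): any closer of W-ALL row 6 removes the A6 corner from the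
kernel partition.** `CornersAll.bsdp_allCurves_of_not_corner_of_not_cornerF` VERBATIM — same fourteen
published facts, same domain «`W` has CM, or `p` odd and (good, or multiplicative with `r = 0`)»,
same CM corner `CornerF` — except that the non-CM corner list loses
`¬ (ClassX6 W p ∧ W.analyticRank = 0)` (eight ↦ seven), granted `h6 : WAllCornerX6r0`. On the deleted
corner the pair is non-CM (hypothesis of `hA`'s reading) and `p ≠ 2` (the domain), exactly row 6's
binders. Pure logic; nothing asserted. [folklore] -/
theorem bsdp_allCurves_of_not_corner_of_not_cornerF_of_wallCornerX6r0 (h6 : WAllCornerX6r0)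
    (hSk : Skinner2016.thmC_padicValRat_bsd_rank_zero)
    (hBCS : BurungaleCastellaSkinner2025.cor131_padicValRat_bsd_rank_le_one)
    (hJSW : JetchevSkinnerWan2017.thm121_padicValRat_bsd_rank_one)
    (hCGS : CastellaGrossiSkinner2025.thmD_padicValRat_bsd_rank_le_one)
    (hGV : GreenbergVatsal2000.thm13_charIdeal_eq_of_gvPar) (hGr : greenberg_charValue_rankZero)
    (hmod : hasEntireLFunction_rat) (hmodP : nonempty_modularParametrizationData)
    (hGZK : rank_eq_analyticRank_of_analyticRank_le_one)
    (hCM : bsdTriple_of_hasCM_of_L_one_ne_zero) (hKob : Kobayashi2013.cor14_bsdp_of_cm_rank_one)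
    (hYZ : YanZhu2026.thm415_padicValRat_bsd_rank_le_one)
    (hW20 : Wuthrich2014.lemma20_surjective_threeAdic_of_semistable)
    (hLLT : LiLiuTian2024.thm11_bsdp_of_cm_rank_one)
    (hr : W.analyticRank ≤ 1)
    (hdom : W.HasCM ∨ (p ≠ 2 ∧ (Good W p ∨ (Mult W p ∧ W.analyticRank = 0))))
    (hA : ¬ W.HasCM → ¬ ClassX1 W p ∧ ¬ ClassX9 W p ∧ ¬ (ClassX10 W p ∧ ¬ Surj W p) ∧
      ¬ ClassX7 W p ∧ ¬ ClassX8 W p ∧ ¬ ClassX11a W p ∧ ¬ ClassX2 W p)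
    (hF : W.HasCM → ¬ CornerF W p) : BSDp W p := by
  by_cases hcm : W.HasCM
  · exact bsdp_cm_of_not_cornerF hCM hmod hLLT hKob hcm hr (hF hcm)
  · rcases hdom with h | ⟨hp, hdom⟩
    · exact absurd h hcm
    · by_cases hX6 : ClassX6 W p ∧ W.analyticRank = 0
      · exact h6 W p hcm hp hX6.1 hX6.2
      · obtain ⟨hX1, hX9, hX10b, hX7, hX8, hX11a, hX2⟩ := hA hcm
        exact bsdp_of_not_corner hSk hBCS hJSW hCGS hGV hGr hmod hmodP hGZK hCM hKob hYZ hW20 hLLT hr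
          hcm hp hdom hX1 hX9 hX10b hX6 hX7 hX8 hX11a hX2

/-- **The kernel partition, A6 deleted, from BSTW Thm. 1.5 BY NAME**: for every elliptic `E/ℚ`
(globally minimal `W`) of analytic rank `≤ 1` and every prime `p` in the domain «`W` has CM, or `p`
odd and (good, or multiplicative with `r = 0`)», `BSD(E,p)` holds outside the SEVEN non-CM corners
X1 / X9 / X10 ∧ ¬Surj / X7 / X8 / X11a / X2 (read only when `¬ cm`) and outside `CornerF` (read only
when `cm`) — granted the fourteen published facts of `CornersAll` and ONE announced statement, Thm. 1.5
of Burungale–Skinner–Tian–Wan (`hBSTW`, PRE). CONDITIONAL; closes nothing; books nothing (R-0.1).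
[cite: BurungaleSkinnerTianWan2024, Thm. 1.5 (p. 4; PRE, OPEN binder)] [cite: Miller2011LMS, §1 and Def. 1.1] -/
theorem bsdp_allCurves_of_not_corner_of_not_cornerF_of_bstw15_OPEN (hBSTW : thm15_pPart_OPEN)
    (hSk : Skinner2016.thmC_padicValRat_bsd_rank_zero)
    (hBCS : BurungaleCastellaSkinner2025.cor131_padicValRat_bsd_rank_le_one)
    (hJSW : JetchevSkinnerWan2017.thm121_padicValRat_bsd_rank_one)
    (hCGS : CastellaGrossiSkinner2025.thmD_padicValRat_bsd_rank_le_one)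
    (hGV : GreenbergVatsal2000.thm13_charIdeal_eq_of_gvPar) (hGr : greenberg_charValue_rankZero)
    (hmod : hasEntireLFunction_rat) (hmodP : nonempty_modularParametrizationData)
    (hGZK : rank_eq_analyticRank_of_analyticRank_le_one)
    (hCM : bsdTriple_of_hasCM_of_L_one_ne_zero) (hKob : Kobayashi2013.cor14_bsdp_of_cm_rank_one)
    (hYZ : YanZhu2026.thm415_padicValRat_bsd_rank_le_one)
    (hW20 : Wuthrich2014.lemma20_surjective_threeAdic_of_semistable)
    (hLLT : LiLiuTian2024.thm11_bsdp_of_cm_rank_one)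
    (hr : W.analyticRank ≤ 1)
    (hdom : W.HasCM ∨ (p ≠ 2 ∧ (Good W p ∨ (Mult W p ∧ W.analyticRank = 0))))
    (hA : ¬ W.HasCM → ¬ ClassX1 W p ∧ ¬ ClassX9 W p ∧ ¬ (ClassX10 W p ∧ ¬ Surj W p) ∧
      ¬ ClassX7 W p ∧ ¬ ClassX8 W p ∧ ¬ ClassX11a W p ∧ ¬ ClassX2 W p)
    (hF : W.HasCM → ¬ CornerF W p) : BSDp W p :=
  bsdp_allCurves_of_not_corner_of_not_cornerF_of_wallCornerX6r0
    (wallCornerX6r0_of_bstw15_OPEN hBSTW hGZK) hSk hBCS hJSW hCGS hGV hGr hmod hmodP hGZK hCM hKob hYZ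
    hW20 hLLT hr hdom hA hF

/-- **`Corners.bsdp_of_not_corner'` with the A6 corner deleted, from BSTW Thm. 1.5 BY NAME**: every
`E/ℚ` (CM or not; globally minimal `W`) of analytic rank `≤ 1`, every ODD `p` with `p` good, or `p`
multiplicative and `r = 0`, outside the seven non-CM corners X1 / X9 / X10 ∧ ¬Surj / X7 / X8 / X11a /
X2 ⇒ `BSD(E,p)` — the fourteen published facts of `Corners.bsdp_of_not_corner'` + Thm. 1.5 (`hBSTW`,
PRE). (A CM pair needs no corner on this domain: `Corners.bsdp_cm_of_good_or_mult_rankZero`; an X6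
pair is never CM: `ClassX6.not_hasCM`.) CONDITIONAL; closes nothing; books nothing (R-0.1).
[cite: BurungaleSkinnerTianWan2024, Thm. 1.5 (p. 4; PRE, OPEN binder)] [cite: Miller2011LMS, §1 and Def. 1.1] -/
theorem bsdp_of_not_corner'_of_bstw15_OPEN (hBSTW : thm15_pPart_OPEN)
    (hSk : Skinner2016.thmC_padicValRat_bsd_rank_zero)
    (hBCS : BurungaleCastellaSkinner2025.cor131_padicValRat_bsd_rank_le_one)
    (hJSW : JetchevSkinnerWan2017.thm121_padicValRat_bsd_rank_one)
    (hCGS : CastellaGrossiSkinner2025.thmD_padicValRat_bsd_rank_le_one)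
    (hGV : GreenbergVatsal2000.thm13_charIdeal_eq_of_gvPar) (hGr : greenberg_charValue_rankZero)
    (hmod : hasEntireLFunction_rat) (hmodP : nonempty_modularParametrizationData)
    (hGZK : rank_eq_analyticRank_of_analyticRank_le_one)
    (hCM : bsdTriple_of_hasCM_of_L_one_ne_zero) (hKob : Kobayashi2013.cor14_bsdp_of_cm_rank_one)
    (hYZ : YanZhu2026.thm415_padicValRat_bsd_rank_le_one)
    (hW20 : Wuthrich2014.lemma20_surjective_threeAdic_of_semistable)
    (hLLT : LiLiuTian2024.thm11_bsdp_of_cm_rank_one)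
    (hr : W.analyticRank ≤ 1) (hp : p ≠ 2)
    (hdom : Good W p ∨ (Mult W p ∧ W.analyticRank = 0))
    (hX1 : ¬ ClassX1 W p) (hX9 : ¬ ClassX9 W p) (hX10b : ¬ (ClassX10 W p ∧ ¬ Surj W p))
    (hX7 : ¬ ClassX7 W p) (hX8 : ¬ ClassX8 W p)
    (hX11a : ¬ ClassX11a W p) (hX2 : ¬ ClassX2 W p) : BSDp W p := by
  by_cases hX6 : ClassX6 W p ∧ W.analyticRank = 0
  · exact X6.bsdp_of_thm15_OPEN' hBSTW hGZK W p hp hX6.1 hr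
  · exact bsdp_of_not_corner' hSk hBCS hJSW hCGS hGV hGr hmod hmodP hGZK hCM hKob hYZ hW20 hLLT hr hp
      hdom hX1 hX9 hX10b hX6 hX7 hX8 hX11a hX2

end Partition

end Summit.BirchSwinnertonDyer.Rank1Residual.PrintX6

end
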